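import Summits.CriticalPhenomena.PercolationContinuityZ3.Theorems.Transplant.FKThreeApexCap
import HarnessLib

/-!
# The three-apex monoid: the HARMONIC CAP — the exact tangent cone of the monoid at the identity

Helper file (`--supports stmt-CriticalPhenomena-4575`), FK sub-lane `prim-bschramm-fk-3` (gen 18); builds on p205010 (kernel theorem,
internal audit signed; external expert review pending).  No sorries; standard axioms.  Memo `bschramm/prim-bschramm-fk-3/T3-HARMONIC.md`.

In hat coordinates `û = Z₀, x̂ = Z₀+Z_ab, ŷ = Z₀+Z_ac, ẑ = Z₀+Z_bc, v̂ = |Z|` the letter action of the three-apex monoid `InK q` is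
coordinatewise multiplication, so `E(Z) := v̂û²/(x̂ŷẑ)` is multiplicative.  The three caps of file `…Cap` say `E ≤ 1 + q·A_g`
(`A_g = Z_g/Z₀`) for each two-block `g`.  This file proves their common sharpening, the **harmonic cap**

  `harmCap q Z := x̂ŷẑ·(û·e₂ + q·e₃) − v̂·û³·e₂ ≥ 0`,  `e₂ = Z_abZ_ac + Z_abZ_bc + Z_acZ_bc`,  `e₃ = Z_abZ_acZ_bc`,

i.e. `E ≤ 1 + q·h(A)` with the HARMONIC form `h(A) = e₃(A)/e₂(A) = 1/(1/A_ab + 1/A_ac + 1/A_bc)` — the exact second-order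
(tangent-cone) constraint of the monoid at the identity word, where the caps and the `U`-inequalities are not tight.
Proof: for a letter the form has non-negative coefficients (`IsLetter.harmCap_nonneg`); multiplicativity of `E` and the
**semigroup inequality** `h(A) + h(B) + h(A)h(B) ≤ h(C)` for the product ratios `C_g = A_g + B_g + A_gB_g`
(`harm_semigroup`, an explicit sum of squares: in reciprocal variables it is the superadditivity of `xy/(1+x+y)`), with the
caps covering the degenerate words (`e₂ = 0`).  Main result: `InK.harmCap_nonneg`.  With the fibre-top certificate of file
`…T3EnvelopeHarmTop` it yields `EnvelopeA q` for every `0 < q ≤ 1` (file `…T3EnvelopeAllQ`). [folklore]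
-/

noncomputable section

namespace Summit.CriticalPhenomena.PercolationContinuityZ3.Theorems

namespace FK

namespace ThreeApex

/-! ### The forms -/

/-- `e₂(a,b,c) = ab + ac + bc`. [folklore] -/
def hE2 (a b c : ℝ) : ℝ := a * b + a * c + b * c

/-- `e₃(a,b,c) = abc`. [folklore] -/
def hE3 (a b c : ℝ) : ℝ := a * b * c

/-- The generic harmonic-cap functional `Φ(W,v,u;m) = W(u·e₂(m) + q·e₃(m)) − v·u³·e₂(m)` (`W` plays `x̂ŷẑ`, `v` the total mass,
`u = Z₀`, `m` the three two-block masses). [folklore] -/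
def harmPhi (W v u q a b c : ℝ) : ℝ := W * (u * hE2 a b c + q * hE3 a b c) - v * u ^ 3 * hE2 a b c

/-- **The harmonic cap form** `x̂ŷẑ(û e₂ + q e₃) − v̂ û³ e₂` of a five-vector. [folklore] -/
def harmCap (q : ℝ) (Z : V5) : ℝ := harmPhi (hx Z * hy Z * hz Z) Z.total Z.z0 q Z.zab Z.zac Z.zbc

/-! ### Polynomial facts -/

/-- `e₂, e₃ ≥ 0` on the orthant. [folklore] -/
theorem hE2_nonneg {a b c : ℝ} (ha : 0 ≤ a) (hb : 0 ≤ b) (hc : 0 ≤ c) : 0 ≤ hE2 a b c := by unfold hE2; positivity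

/-- `e₃ ≥ 0` on the orthant. [folklore] -/
theorem hE3_nonneg {a b c : ℝ} (ha : 0 ≤ a) (hb : 0 ≤ b) (hc : 0 ≤ c) : 0 ≤ hE3 a b c := by unfold hE3; positivity

/-- `e₂ = 0` on the orthant forces two of the three masses to vanish: `a = 0 ∨ (b = 0 ∧ c = 0)`. [folklore] -/
theorem hE2_eq_zero {a b c : ℝ} (ha : 0 ≤ a) (hb : 0 ≤ b) (hc : 0 ≤ c) (h : hE2 a b c = 0) : a = 0 ∨ (b = 0 ∧ c = 0) := by
  unfold hE2 at h
  have hab := mul_nonneg ha hb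
  have hac := mul_nonneg ha hc
  have hbc := mul_nonneg hb hc
  have h1 : a * b = 0 := by linarith
  have h2 : a * c = 0 := by linarith
  rcases mul_eq_zero.1 h1 with h | h
  · exact Or.inl h
  · rcases mul_eq_zero.1 h2 with h' | h'
    · exact Or.inl h'
    · exact Or.inr ⟨h, h'⟩

/-- **Monotonicity of the harmonic form**: `e₃(m+d)·e₂(m) ≥ e₃(m)·e₂(m+d)` for `m, d ≥ 0` (`h = e₃/e₂` is non-decreasing). [folklore] -/
theorem hE3_mul_hE2_mono {m₁ m₂ m₃ d₁ d₂ d₃ : ℝ} (h₁ : 0 ≤ m₁) (h₂ : 0 ≤ m₂) (h₃ : 0 ≤ m₃) (e₁ : 0 ≤ d₁) (e₂ : 0 ≤ d₂)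
    (e₃ : 0 ≤ d₃) : hE3 m₁ m₂ m₃ * hE2 (m₁ + d₁) (m₂ + d₂) (m₃ + d₃) ≤ hE3 (m₁ + d₁) (m₂ + d₂) (m₃ + d₃) * hE2 m₁ m₂ m₃ := by
  have e : hE3 (m₁ + d₁) (m₂ + d₂) (m₃ + d₃) * hE2 m₁ m₂ m₃ - hE3 m₁ m₂ m₃ * hE2 (m₁ + d₁) (m₂ + d₂) (m₃ + d₃)
      = m₂ * m₃ * d₁ * d₂ * d₃ + m₂ * m₃ ^ 2 * d₁ * d₂ + m₂ ^ 2 * m₃ * d₁ * d₃ + m₂ ^ 2 * m₃ ^ 2 * d₁ + m₁ * m₃ * d₁ * d₂ * d₃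
        + m₁ * m₃ ^ 2 * d₁ * d₂ + m₁ * m₂ * d₁ * d₂ * d₃ + m₁ * m₂ ^ 2 * d₁ * d₃ + m₁ ^ 2 * m₃ * d₂ * d₃ + m₁ ^ 2 * m₃ ^ 2 * d₂
        + m₁ ^ 2 * m₂ * d₂ * d₃ + m₁ ^ 2 * m₂ ^ 2 * d₃ := by
    unfold hE2 hE3; ring
  have : 0 ≤ hE3 (m₁ + d₁) (m₂ + d₂) (m₃ + d₃) * hE2 m₁ m₂ m₃ - hE3 m₁ m₂ m₃ * hE2 (m₁ + d₁) (m₂ + d₂) (m₃ + d₃) := by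
    rw [e]; positivity
  linarith

set_option maxHeartbeats 2000000 in
/-- **The semigroup inequality** (homogeneous form).  For the product of a word with masses `(u; a,b,c)` and a letter with masses
`(w; p,r,s)` the two-block masses are `m_g' = (w + z_g)·Z_g + z_g·u`; then
`e₂(m')·(w·e₃(Z)e₂(z) + u·e₃(z)e₂(Z) + e₃(Z)e₃(z)) ≤ e₃(m')·e₂(Z)·e₂(z)` — in reciprocal ratio variables this is the superadditivity
of `xy/(1+x+y)`; here an explicit sum of squares. [folklore] -/
theorem harm_semigroup {u a b c w p r s : ℝ} (hu : 0 ≤ u) (ha : 0 ≤ a) (hb : 0 ≤ b) (hc : 0 ≤ c) (hw : 0 ≤ w) (hp : 0 ≤ p)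
    (hr : 0 ≤ r) (hs : 0 ≤ s) :
    hE2 ((w + p) * a + p * u) ((w + r) * b + r * u) ((w + s) * c + s * u) * (w * hE3 a b c * hE2 p r s + u * hE3 p r s * hE2 a b c
        + hE3 a b c * hE3 p r s)
      ≤ hE3 ((w + p) * a + p * u) ((w + r) * b + r * u) ((w + s) * c + s * u) * hE2 a b c * hE2 p r s := by
  have e : hE3 ((w + p) * a + p * u) ((w + r) * b + r * u) ((w + s) * c + s * u) * hE2 a b c * hE2 p r s
      - hE2 ((w + p) * a + p * u) ((w + r) * b + r * u) ((w + s) * c + s * u) * (w * hE3 a b c * hE2 p r s + u * hE3 p r s * hE2 a b c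
        + hE3 a b c * hE3 p r s) =
    u * c ^ (2 : ℕ) * w * s ^ (2 : ℕ) * (b * p - a * r) ^ 2
    + u * c ^ (2 : ℕ) * w ^ (2 : ℕ) * s * (b * p - a * r) ^ 2
    + u * b ^ (2 : ℕ) * w * r ^ (2 : ℕ) * (c * p - a * s) ^ 2
    + u * b ^ (2 : ℕ) * w ^ (2 : ℕ) * r * (c * p - a * s) ^ 2
    + u * a ^ (2 : ℕ) * w * p ^ (2 : ℕ) * (c * r - b * s) ^ 2
    + u * a ^ (2 : ℕ) * w ^ (2 : ℕ) * p * (c * r - b * s) ^ 2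
    + u ^ (2 : ℕ) * c * w * s ^ (2 : ℕ) * (b * p - a * r) ^ 2
    + u ^ (2 : ℕ) * b * w * r ^ (2 : ℕ) * (c * p - a * s) ^ 2
    + u ^ (2 : ℕ) * a * w * p ^ (2 : ℕ) * (c * r - b * s) ^ 2
    + (a * b ^ (2 : ℕ) * c ^ (2 : ℕ) * p ^ (2 : ℕ) * r * s ^ (2 : ℕ) + a * b ^ (2 : ℕ) * c ^ (2 : ℕ) * p ^ (2 : ℕ) * r ^ (2 : ℕ) * s + a * b ^ (2 : ℕ) * c ^ (2 : ℕ) * w * p ^ (2 : ℕ) * s ^ (2 : ℕ) + (2:ℝ) * a * b ^ (2 : ℕ) * c ^ (2 : ℕ) * w * p ^ (2 : ℕ) * r * s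
        + a * b ^ (2 : ℕ) * c ^ (2 : ℕ) * w * p ^ (2 : ℕ) * r ^ (2 : ℕ) + a * b ^ (2 : ℕ) * c ^ (2 : ℕ) * w ^ (2 : ℕ) * p ^ (2 : ℕ) * s + a * b ^ (2 : ℕ) * c ^ (2 : ℕ) * w ^ (2 : ℕ) * p ^ (2 : ℕ) * r + a ^ (2 : ℕ) * b * c ^ (2 : ℕ) * p * r ^ (2 : ℕ) * s ^ (2 : ℕ)
        + a ^ (2 : ℕ) * b * c ^ (2 : ℕ) * p ^ (2 : ℕ) * r ^ (2 : ℕ) * s + a ^ (2 : ℕ) * b * c ^ (2 : ℕ) * w * r ^ (2 : ℕ) * s ^ (2 : ℕ) + (2:ℝ) * a ^ (2 : ℕ) * b * c ^ (2 : ℕ) * w * p * r ^ (2 : ℕ) * s + a ^ (2 : ℕ) * b * c ^ (2 : ℕ) * w * p ^ (2 : ℕ) * r ^ (2 : ℕ)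
        + a ^ (2 : ℕ) * b * c ^ (2 : ℕ) * w ^ (2 : ℕ) * r ^ (2 : ℕ) * s + a ^ (2 : ℕ) * b * c ^ (2 : ℕ) * w ^ (2 : ℕ) * p * r ^ (2 : ℕ) + a ^ (2 : ℕ) * b ^ (2 : ℕ) * c * p * r ^ (2 : ℕ) * s ^ (2 : ℕ) + a ^ (2 : ℕ) * b ^ (2 : ℕ) * c * p ^ (2 : ℕ) * r * s ^ (2 : ℕ)
        + a ^ (2 : ℕ) * b ^ (2 : ℕ) * c * w * r ^ (2 : ℕ) * s ^ (2 : ℕ) + (2:ℝ) * a ^ (2 : ℕ) * b ^ (2 : ℕ) * c * w * p * r * s ^ (2 : ℕ) + a ^ (2 : ℕ) * b ^ (2 : ℕ) * c * w * p ^ (2 : ℕ) * s ^ (2 : ℕ) + a ^ (2 : ℕ) * b ^ (2 : ℕ) * c * w ^ (2 : ℕ) * r * s ^ (2 : ℕ)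
        + a ^ (2 : ℕ) * b ^ (2 : ℕ) * c * w ^ (2 : ℕ) * p * s ^ (2 : ℕ) + u * b ^ (2 : ℕ) * c ^ (2 : ℕ) * p ^ (2 : ℕ) * r * s ^ (2 : ℕ) + u * b ^ (2 : ℕ) * c ^ (2 : ℕ) * p ^ (2 : ℕ) * r ^ (2 : ℕ) * s + (2:ℝ) * u * b ^ (2 : ℕ) * c ^ (2 : ℕ) * w * p ^ (2 : ℕ) * r * s
        + (2:ℝ) * u * a * b * c ^ (2 : ℕ) * p ^ (2 : ℕ) * r ^ (2 : ℕ) * s + (2:ℝ) * u * a * b * c ^ (2 : ℕ) * w * p ^ (2 : ℕ) * r ^ (2 : ℕ) + (2:ℝ) * u * a * b ^ (2 : ℕ) * c * p ^ (2 : ℕ) * r * s ^ (2 : ℕ) + (2:ℝ) * u * a * b ^ (2 : ℕ) * c * w * p ^ (2 : ℕ) * s ^ (2 : ℕ)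
        + u * a ^ (2 : ℕ) * c ^ (2 : ℕ) * p * r ^ (2 : ℕ) * s ^ (2 : ℕ) + u * a ^ (2 : ℕ) * c ^ (2 : ℕ) * p ^ (2 : ℕ) * r ^ (2 : ℕ) * s + (2:ℝ) * u * a ^ (2 : ℕ) * c ^ (2 : ℕ) * w * p * r ^ (2 : ℕ) * s + (2:ℝ) * u * a ^ (2 : ℕ) * b * c * p * r ^ (2 : ℕ) * s ^ (2 : ℕ)
        + (2:ℝ) * u * a ^ (2 : ℕ) * b * c * w * r ^ (2 : ℕ) * s ^ (2 : ℕ) + u * a ^ (2 : ℕ) * b ^ (2 : ℕ) * p * r ^ (2 : ℕ) * s ^ (2 : ℕ) + u * a ^ (2 : ℕ) * b ^ (2 : ℕ) * p ^ (2 : ℕ) * r * s ^ (2 : ℕ) + (2:ℝ) * u * a ^ (2 : ℕ) * b ^ (2 : ℕ) * w * p * r * s ^ (2 : ℕ)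
        + u ^ (2 : ℕ) * b * c ^ (2 : ℕ) * p ^ (2 : ℕ) * r ^ (2 : ℕ) * s + u ^ (2 : ℕ) * b ^ (2 : ℕ) * c * p ^ (2 : ℕ) * r * s ^ (2 : ℕ) + u ^ (2 : ℕ) * a * c ^ (2 : ℕ) * p ^ (2 : ℕ) * r ^ (2 : ℕ) * s + u ^ (2 : ℕ) * a * b ^ (2 : ℕ) * p ^ (2 : ℕ) * r * s ^ (2 : ℕ)
        + u ^ (2 : ℕ) * a ^ (2 : ℕ) * c * p * r ^ (2 : ℕ) * s ^ (2 : ℕ) + u ^ (2 : ℕ) * a ^ (2 : ℕ) * b * p * r ^ (2 : ℕ) * s ^ (2 : ℕ)) := by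
    unfold hE2 hE3; ring
  have h0 : 0 ≤ hE3 ((w + p) * a + p * u) ((w + r) * b + r * u) ((w + s) * c + s * u) * hE2 a b c * hE2 p r s
      - hE2 ((w + p) * a + p * u) ((w + r) * b + r * u) ((w + s) * c + s * u) * (w * hE3 a b c * hE2 p r s + u * hE3 p r s * hE2 a b c
        + hE3 a b c * hE3 p r s) := by
    rw [e]; positivity
  linarith

/-- **Monotonicity of the cap functional in the masses.**  If `Φ(W,v,u;m) ≥ 0`, `m ≤ n` coordinatewise, and either the `e₂`-coefficient
`Wu − vu³` is non-negative or `e₂(m) > 0`, then `Φ(W,v,u;n) ≥ 0`. [folklore] -/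
theorem harmPhi_mono {W v u q m₁ m₂ m₃ n₁ n₂ n₃ : ℝ} (hW : 0 ≤ W) (hq : 0 ≤ q) (hm₁ : 0 ≤ m₁) (hm₂ : 0 ≤ m₂)
    (hm₃ : 0 ≤ m₃) (h₁ : m₁ ≤ n₁) (h₂ : m₂ ≤ n₂) (h₃ : m₃ ≤ n₃) (hcase : v * u ^ 3 ≤ W * u ∨ 0 < hE2 m₁ m₂ m₃)
    (h : 0 ≤ harmPhi W v u q m₁ m₂ m₃) : 0 ≤ harmPhi W v u q n₁ n₂ n₃ := by
  have hn₁ : 0 ≤ n₁ := hm₁.trans h₁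
  have hn₂ : 0 ≤ n₂ := hm₂.trans h₂
  have hn₃ : 0 ≤ n₃ := hm₃.trans h₃
  have he2n := hE2_nonneg hn₁ hn₂ hn₃
  have he3n := hE3_nonneg hn₁ hn₂ hn₃
  have he2m := hE2_nonneg hm₁ hm₂ hm₃
  have eΦ : ∀ x y z : ℝ, harmPhi W v u q x y z = q * W * hE3 x y z - (v * u ^ 3 - W * u) * hE2 x y z := by
    intro x y z; unfold harmPhi; ring
  by_cases hc : v * u ^ 3 ≤ W * u
  · rw [eΦ]
    have : 0 ≤ (W * u - v * u ^ 3) * hE2 n₁ n₂ n₃ := mul_nonneg (by linarith) he2n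
    have : 0 ≤ q * W * hE3 n₁ n₂ n₃ := by positivity
    linarith
  · have hpos : 0 < hE2 m₁ m₂ m₃ := hcase.resolve_left hc
    have hmono := hE3_mul_hE2_mono hm₁ hm₂ hm₃ (sub_nonneg.2 h₁) (sub_nonneg.2 h₂) (sub_nonneg.2 h₃)
    simp only [add_sub_cancel] at hmono
    have h1 : (v * u ^ 3 - W * u) * hE2 m₁ m₂ m₃ ≤ q * W * hE3 m₁ m₂ m₃ := by rw [eΦ] at h; linarith
    have h2 : (v * u ^ 3 - W * u) * hE2 m₁ m₂ m₃ * hE2 n₁ n₂ n₃ ≤ q * W * hE3 m₁ m₂ m₃ * hE2 n₁ n₂ n₃ :=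
      mul_le_mul_of_nonneg_right h1 he2n
    have h3 : q * W * (hE3 m₁ m₂ m₃ * hE2 n₁ n₂ n₃) ≤ q * W * (hE3 n₁ n₂ n₃ * hE2 m₁ m₂ m₃) :=
      mul_le_mul_of_nonneg_left hmono (by positivity)
    have h4 : hE2 m₁ m₂ m₃ * ((v * u ^ 3 - W * u) * hE2 n₁ n₂ n₃ - q * W * hE3 n₁ n₂ n₃) ≤ 0 := by nlinarith [h2, h3]
    have h5 : (v * u ^ 3 - W * u) * hE2 n₁ n₂ n₃ - q * W * hE3 n₁ n₂ n₃ ≤ 0 := by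
      by_contra hcon
      have := mul_pos hpos (not_le.mp hcon)
      linarith
    rw [eΦ]; linarith

/-- **The multiplicative step** (non-degenerate case).  If `Φ(W,v,u;Z) ≥ 0`, `Φ(W₁,v₁,u₁;z) ≥ 0`, `e₂(Z), e₂(z) > 0` and `0 ≤ q ≤ 1`,
then `Φ(W₁W, v₁v, u₁u; m') ≥ 0` for the product masses `m'_g = (u₁ + z_g)Z_g + z_g u`. [folklore] -/
theorem harmPhi_step {W v u W₁ v₁ u₁ q a b c p r s : ℝ} (hW : 0 ≤ W) (hv : 0 ≤ v) (hu : 0 ≤ u) (hW₁ : 0 ≤ W₁) (hv₁ : 0 ≤ v₁)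
    (hu₁ : 0 ≤ u₁) (hq0 : 0 ≤ q) (hq1 : q ≤ 1) (ha : 0 ≤ a) (hb : 0 ≤ b) (hc : 0 ≤ c) (hp : 0 ≤ p) (hr : 0 ≤ r) (hs : 0 ≤ s)
    (hZ : 0 ≤ harmPhi W v u q a b c) (hz : 0 ≤ harmPhi W₁ v₁ u₁ q p r s) (heZ : 0 < hE2 a b c) (hez : 0 < hE2 p r s) :
    0 ≤ harmPhi (W₁ * W) (v₁ * v) (u₁ * u) q ((u₁ + p) * a + p * u) ((u₁ + r) * b + r * u) ((u₁ + s) * c + s * u) := by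
  have h3Z : 0 ≤ hE3 a b c := hE3_nonneg ha hb hc; have h3z : 0 ≤ hE3 p r s := hE3_nonneg hp hr hs
  have hm₁ : 0 ≤ (u₁ + p) * a + p * u := by positivity
  have hm₂ : 0 ≤ (u₁ + r) * b + r * u := by positivity
  have hm₃ : 0 ≤ (u₁ + s) * c + s * u := by positivity
  have h2' : 0 ≤ hE2 ((u₁ + p) * a + p * u) ((u₁ + r) * b + r * u) ((u₁ + s) * c + s * u) := hE2_nonneg hm₁ hm₂ hm₃
  have h3' : 0 ≤ hE3 ((u₁ + p) * a + p * u) ((u₁ + r) * b + r * u) ((u₁ + s) * c + s * u) := hE3_nonneg hm₁ hm₂ hm₃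
  have D : hE2 ((u₁ + p) * a + p * u) ((u₁ + r) * b + r * u) ((u₁ + s) * c + s * u) * (u₁ * hE3 a b c * hE2 p r s + u * hE3 p r s * hE2 a b c + hE3 a b c * hE3 p r s) ≤ hE3 ((u₁ + p) * a + p * u) ((u₁ + r) * b + r * u) ((u₁ + s) * c + s * u) * hE2 a b c * hE2 p r s :=
    harm_semigroup hu ha hb hc hu₁ hp hr hs
  have hX : v * u ^ 3 * hE2 a b c ≤ W * (u * hE2 a b c + q * hE3 a b c) := by unfold harmPhi at hZ; linarith
  have hX₁ : v₁ * u₁ ^ 3 * hE2 p r s ≤ W₁ * (u₁ * hE2 p r s + q * hE3 p r s) := by unfold harmPhi at hz; linarith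
  have hY : 0 ≤ v * u ^ 3 * hE2 a b c := by positivity
  have hY₁ : 0 ≤ v₁ * u₁ ^ 3 * hE2 p r s := by positivity
  have prod : (v * u ^ 3 * hE2 a b c) * (v₁ * u₁ ^ 3 * hE2 p r s) ≤ (W * (u * hE2 a b c + q * hE3 a b c)) * (W₁ * (u₁ * hE2 p r s + q * hE3 p r s)) :=
    mul_le_mul hX hX₁ hY₁ (hY.trans hX)
  have hq2 : q ^ 2 ≤ q := by nlinarith
  have c2 : q * (W₁ * W) * (hE2 ((u₁ + p) * a + p * u) ((u₁ + r) * b + r * u) ((u₁ + s) * c + s * u) * (u₁ * hE3 a b c * hE2 p r s + u * hE3 p r s * hE2 a b c + hE3 a b c * hE3 p r s))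
      ≤ q * (W₁ * W) * (hE3 ((u₁ + p) * a + p * u) ((u₁ + r) * b + r * u) ((u₁ + s) * c + s * u) * hE2 a b c * hE2 p r s) :=
    mul_le_mul_of_nonneg_left D (by positivity)
  have c3 : hE2 ((u₁ + p) * a + p * u) ((u₁ + r) * b + r * u) ((u₁ + s) * c + s * u) * (q ^ 2 * (W₁ * W) * (hE3 a b c * hE3 p r s)) ≤ hE2 ((u₁ + p) * a + p * u) ((u₁ + r) * b + r * u) ((u₁ + s) * c + s * u) * (q * (W₁ * W) * (hE3 a b c * hE3 p r s)) := by
    apply mul_le_mul_of_nonneg_left _ h2'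
    apply mul_le_mul_of_nonneg_right _ (by positivity)
    exact mul_le_mul_of_nonneg_right hq2 (by positivity)
  have c4 : 0 ≤ hE2 ((u₁ + p) * a + p * u) ((u₁ + r) * b + r * u) ((u₁ + s) * c + s * u) * ((W * (u * hE2 a b c + q * hE3 a b c)) * (W₁ * (u₁ * hE2 p r s + q * hE3 p r s)) - (v * u ^ 3 * hE2 a b c) * (v₁ * u₁ ^ 3 * hE2 p r s)) :=
    mul_nonneg h2' (by linarith)
  have i : hE2 a b c * hE2 p r s * harmPhi (W₁ * W) (v₁ * v) (u₁ * u) q ((u₁ + p) * a + p * u) ((u₁ + r) * b + r * u) ((u₁ + s) * c + s * u)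
      = (q * (W₁ * W) * (hE3 ((u₁ + p) * a + p * u) ((u₁ + r) * b + r * u) ((u₁ + s) * c + s * u) * hE2 a b c * hE2 p r s)
          - q * (W₁ * W) * (hE2 ((u₁ + p) * a + p * u) ((u₁ + r) * b + r * u) ((u₁ + s) * c + s * u) * (u₁ * hE3 a b c * hE2 p r s + u * hE3 p r s * hE2 a b c + hE3 a b c * hE3 p r s)))
        + (hE2 ((u₁ + p) * a + p * u) ((u₁ + r) * b + r * u) ((u₁ + s) * c + s * u) * (q * (W₁ * W) * (hE3 a b c * hE3 p r s)) - hE2 ((u₁ + p) * a + p * u) ((u₁ + r) * b + r * u) ((u₁ + s) * c + s * u) * (q ^ 2 * (W₁ * W) * (hE3 a b c * hE3 p r s)))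
        + hE2 ((u₁ + p) * a + p * u) ((u₁ + r) * b + r * u) ((u₁ + s) * c + s * u) * ((W * (u * hE2 a b c + q * hE3 a b c)) * (W₁ * (u₁ * hE2 p r s + q * hE3 p r s)) - (v * u ^ 3 * hE2 a b c) * (v₁ * u₁ ^ 3 * hE2 p r s)) := by
    unfold harmPhi; ring
  have key : 0 ≤ hE2 a b c * hE2 p r s * harmPhi (W₁ * W) (v₁ * v) (u₁ * u) q ((u₁ + p) * a + p * u) ((u₁ + r) * b + r * u) ((u₁ + s) * c + s * u) := by
    rw [i]
    have := sub_nonneg.2 c2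
    have := sub_nonneg.2 c3
    linarith
  have hpos : 0 < hE2 a b c * hE2 p r s := mul_pos heZ hez
  nlinarith [key, hpos]

/-! ### Letters -/

/-- `conv z δ₀ = z`: every letter is a word. [folklore] -/
private theorem conv_delta0_aux (z : V5) : conv z delta0 = z := by
  ext <;> simp [conv, delta0, V5.total]

/-- Every letter lies in the monoid (local copy of `IsLetter.inK` of file `…NegCorr`, to keep the imports light). [folklore] -/
private theorem IsLetter.inK_aux {q : ℝ} {z : V5} (h : IsLetter q z) : InK q z := by
  have := InK.step h InK.base
  rwa [conv_delta0_aux] at this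

/-- Every letter satisfies the harmonic cap (`0 ≤ q`): for a leaf `harmCap` is a polynomial with non-negative coefficients in
`(a, 1−a, b, 1−b, c, 1−c, q)` (48 terms); for the triangle edges `e₂ = 0` and the form vanishes. [folklore] -/
theorem IsLetter.harmCap_nonneg {q : ℝ} (hq0 : 0 ≤ q) {z : V5} (h : IsLetter q z) : 0 ≤ harmCap q z := by
  rcases h with ⟨ha0, ha1, hb0, hb1, hc0, hc1⟩ | ⟨hw0, hw1⟩ | ⟨hw0, hw1⟩ | ⟨hw0, hw1⟩
  · rename_i a b c
    have ha' : (0 : ℝ) ≤ 1 - a := sub_nonneg.2 ha1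
    have hb' : (0 : ℝ) ≤ 1 - b := sub_nonneg.2 hb1
    have hc' : (0 : ℝ) ≤ 1 - c := sub_nonneg.2 hc1
    have e : harmCap q (ThreeApex.leaf q a b c) =
        a ^ (2 : ℕ) * (1 - a) ^ (4 : ℕ) * b ^ (2 : ℕ) * (1 - b) ^ (4 : ℕ) * c ^ (2 : ℕ) * (1 - c) ^ (4 : ℕ) * q ^ (4 : ℕ) + (2:ℝ) * a ^ (2 : ℕ) * (1 - a) ^ (4 : ℕ) * b ^ (2 : ℕ) * (1 - b) ^ (4 : ℕ) * c ^ (3 : ℕ) * (1 - c) ^ (3 : ℕ) * q ^ (3 : ℕ)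
          + a ^ (2 : ℕ) * (1 - a) ^ (4 : ℕ) * b ^ (2 : ℕ) * (1 - b) ^ (4 : ℕ) * c ^ (4 : ℕ) * (1 - c) ^ (2 : ℕ) * q ^ (2 : ℕ) + (2:ℝ) * a ^ (2 : ℕ) * (1 - a) ^ (4 : ℕ) * b ^ (3 : ℕ) * (1 - b) ^ (3 : ℕ) * c ^ (2 : ℕ) * (1 - c) ^ (4 : ℕ) * q ^ (3 : ℕ)
          + (2:ℝ) * a ^ (2 : ℕ) * (1 - a) ^ (4 : ℕ) * b ^ (3 : ℕ) * (1 - b) ^ (3 : ℕ) * c ^ (3 : ℕ) * (1 - c) ^ (3 : ℕ) * q ^ (2 : ℕ) + a ^ (2 : ℕ) * (1 - a) ^ (4 : ℕ) * b ^ (3 : ℕ) * (1 - b) ^ (3 : ℕ) * c ^ (3 : ℕ) * (1 - c) ^ (3 : ℕ) * q ^ (3 : ℕ)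
          + (2:ℝ) * a ^ (2 : ℕ) * (1 - a) ^ (4 : ℕ) * b ^ (3 : ℕ) * (1 - b) ^ (3 : ℕ) * c ^ (4 : ℕ) * (1 - c) ^ (2 : ℕ) * q ^ (2 : ℕ) + a ^ (2 : ℕ) * (1 - a) ^ (4 : ℕ) * b ^ (3 : ℕ) * (1 - b) ^ (3 : ℕ) * c ^ (5 : ℕ) * (1 - c) * q
          + a ^ (2 : ℕ) * (1 - a) ^ (4 : ℕ) * b ^ (4 : ℕ) * (1 - b) ^ (2 : ℕ) * c ^ (2 : ℕ) * (1 - c) ^ (4 : ℕ) * q ^ (2 : ℕ) + (2:ℝ) * a ^ (2 : ℕ) * (1 - a) ^ (4 : ℕ) * b ^ (4 : ℕ) * (1 - b) ^ (2 : ℕ) * c ^ (3 : ℕ) * (1 - c) ^ (3 : ℕ) * q ^ (2 : ℕ)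
          + (2:ℝ) * a ^ (2 : ℕ) * (1 - a) ^ (4 : ℕ) * b ^ (4 : ℕ) * (1 - b) ^ (2 : ℕ) * c ^ (4 : ℕ) * (1 - c) ^ (2 : ℕ) * q + a ^ (2 : ℕ) * (1 - a) ^ (4 : ℕ) * b ^ (5 : ℕ) * (1 - b) * c ^ (3 : ℕ) * (1 - c) ^ (3 : ℕ) * q
          + (2:ℝ) * a ^ (3 : ℕ) * (1 - a) ^ (3 : ℕ) * b ^ (2 : ℕ) * (1 - b) ^ (4 : ℕ) * c ^ (2 : ℕ) * (1 - c) ^ (4 : ℕ) * q ^ (3 : ℕ) + (2:ℝ) * a ^ (3 : ℕ) * (1 - a) ^ (3 : ℕ) * b ^ (2 : ℕ) * (1 - b) ^ (4 : ℕ) * c ^ (3 : ℕ) * (1 - c) ^ (3 : ℕ) * q ^ (2 : ℕ)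
          + a ^ (3 : ℕ) * (1 - a) ^ (3 : ℕ) * b ^ (2 : ℕ) * (1 - b) ^ (4 : ℕ) * c ^ (3 : ℕ) * (1 - c) ^ (3 : ℕ) * q ^ (3 : ℕ) + (2:ℝ) * a ^ (3 : ℕ) * (1 - a) ^ (3 : ℕ) * b ^ (2 : ℕ) * (1 - b) ^ (4 : ℕ) * c ^ (4 : ℕ) * (1 - c) ^ (2 : ℕ) * q ^ (2 : ℕ)
          + a ^ (3 : ℕ) * (1 - a) ^ (3 : ℕ) * b ^ (2 : ℕ) * (1 - b) ^ (4 : ℕ) * c ^ (5 : ℕ) * (1 - c) * q + (2:ℝ) * a ^ (3 : ℕ) * (1 - a) ^ (3 : ℕ) * b ^ (3 : ℕ) * (1 - b) ^ (3 : ℕ) * c ^ (2 : ℕ) * (1 - c) ^ (4 : ℕ) * q ^ (2 : ℕ)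
          + a ^ (3 : ℕ) * (1 - a) ^ (3 : ℕ) * b ^ (3 : ℕ) * (1 - b) ^ (3 : ℕ) * c ^ (2 : ℕ) * (1 - c) ^ (4 : ℕ) * q ^ (3 : ℕ) + (6:ℝ) * a ^ (3 : ℕ) * (1 - a) ^ (3 : ℕ) * b ^ (3 : ℕ) * (1 - b) ^ (3 : ℕ) * c ^ (3 : ℕ) * (1 - c) ^ (3 : ℕ) * q ^ (2 : ℕ)
          + (6:ℝ) * a ^ (3 : ℕ) * (1 - a) ^ (3 : ℕ) * b ^ (3 : ℕ) * (1 - b) ^ (3 : ℕ) * c ^ (4 : ℕ) * (1 - c) ^ (2 : ℕ) * q + a ^ (3 : ℕ) * (1 - a) ^ (3 : ℕ) * b ^ (3 : ℕ) * (1 - b) ^ (3 : ℕ) * c ^ (4 : ℕ) * (1 - c) ^ (2 : ℕ) * q ^ (2 : ℕ)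
          + a ^ (3 : ℕ) * (1 - a) ^ (3 : ℕ) * b ^ (3 : ℕ) * (1 - b) ^ (3 : ℕ) * c ^ (5 : ℕ) * (1 - c) + a ^ (3 : ℕ) * (1 - a) ^ (3 : ℕ) * b ^ (3 : ℕ) * (1 - b) ^ (3 : ℕ) * c ^ (5 : ℕ) * (1 - c) * q
          + (2:ℝ) * a ^ (3 : ℕ) * (1 - a) ^ (3 : ℕ) * b ^ (4 : ℕ) * (1 - b) ^ (2 : ℕ) * c ^ (2 : ℕ) * (1 - c) ^ (4 : ℕ) * q ^ (2 : ℕ) + (6:ℝ) * a ^ (3 : ℕ) * (1 - a) ^ (3 : ℕ) * b ^ (4 : ℕ) * (1 - b) ^ (2 : ℕ) * c ^ (3 : ℕ) * (1 - c) ^ (3 : ℕ) * q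
          + a ^ (3 : ℕ) * (1 - a) ^ (3 : ℕ) * b ^ (4 : ℕ) * (1 - b) ^ (2 : ℕ) * c ^ (3 : ℕ) * (1 - c) ^ (3 : ℕ) * q ^ (2 : ℕ) + (2:ℝ) * a ^ (3 : ℕ) * (1 - a) ^ (3 : ℕ) * b ^ (4 : ℕ) * (1 - b) ^ (2 : ℕ) * c ^ (4 : ℕ) * (1 - c) ^ (2 : ℕ)
          + (2:ℝ) * a ^ (3 : ℕ) * (1 - a) ^ (3 : ℕ) * b ^ (4 : ℕ) * (1 - b) ^ (2 : ℕ) * c ^ (4 : ℕ) * (1 - c) ^ (2 : ℕ) * q + a ^ (3 : ℕ) * (1 - a) ^ (3 : ℕ) * b ^ (5 : ℕ) * (1 - b) * c ^ (2 : ℕ) * (1 - c) ^ (4 : ℕ) * q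
          + a ^ (3 : ℕ) * (1 - a) ^ (3 : ℕ) * b ^ (5 : ℕ) * (1 - b) * c ^ (3 : ℕ) * (1 - c) ^ (3 : ℕ) + a ^ (3 : ℕ) * (1 - a) ^ (3 : ℕ) * b ^ (5 : ℕ) * (1 - b) * c ^ (3 : ℕ) * (1 - c) ^ (3 : ℕ) * q
          + a ^ (4 : ℕ) * (1 - a) ^ (2 : ℕ) * b ^ (2 : ℕ) * (1 - b) ^ (4 : ℕ) * c ^ (2 : ℕ) * (1 - c) ^ (4 : ℕ) * q ^ (2 : ℕ) + (2:ℝ) * a ^ (4 : ℕ) * (1 - a) ^ (2 : ℕ) * b ^ (2 : ℕ) * (1 - b) ^ (4 : ℕ) * c ^ (3 : ℕ) * (1 - c) ^ (3 : ℕ) * q ^ (2 : ℕ)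
          + (2:ℝ) * a ^ (4 : ℕ) * (1 - a) ^ (2 : ℕ) * b ^ (2 : ℕ) * (1 - b) ^ (4 : ℕ) * c ^ (4 : ℕ) * (1 - c) ^ (2 : ℕ) * q + (2:ℝ) * a ^ (4 : ℕ) * (1 - a) ^ (2 : ℕ) * b ^ (3 : ℕ) * (1 - b) ^ (3 : ℕ) * c ^ (2 : ℕ) * (1 - c) ^ (4 : ℕ) * q ^ (2 : ℕ)
          + (6:ℝ) * a ^ (4 : ℕ) * (1 - a) ^ (2 : ℕ) * b ^ (3 : ℕ) * (1 - b) ^ (3 : ℕ) * c ^ (3 : ℕ) * (1 - c) ^ (3 : ℕ) * q + a ^ (4 : ℕ) * (1 - a) ^ (2 : ℕ) * b ^ (3 : ℕ) * (1 - b) ^ (3 : ℕ) * c ^ (3 : ℕ) * (1 - c) ^ (3 : ℕ) * q ^ (2 : ℕ)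
          + (2:ℝ) * a ^ (4 : ℕ) * (1 - a) ^ (2 : ℕ) * b ^ (3 : ℕ) * (1 - b) ^ (3 : ℕ) * c ^ (4 : ℕ) * (1 - c) ^ (2 : ℕ) + (2:ℝ) * a ^ (4 : ℕ) * (1 - a) ^ (2 : ℕ) * b ^ (3 : ℕ) * (1 - b) ^ (3 : ℕ) * c ^ (4 : ℕ) * (1 - c) ^ (2 : ℕ) * q
          + (2:ℝ) * a ^ (4 : ℕ) * (1 - a) ^ (2 : ℕ) * b ^ (4 : ℕ) * (1 - b) ^ (2 : ℕ) * c ^ (2 : ℕ) * (1 - c) ^ (4 : ℕ) * q + (2:ℝ) * a ^ (4 : ℕ) * (1 - a) ^ (2 : ℕ) * b ^ (4 : ℕ) * (1 - b) ^ (2 : ℕ) * c ^ (3 : ℕ) * (1 - c) ^ (3 : ℕ)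
          + (2:ℝ) * a ^ (4 : ℕ) * (1 - a) ^ (2 : ℕ) * b ^ (4 : ℕ) * (1 - b) ^ (2 : ℕ) * c ^ (3 : ℕ) * (1 - c) ^ (3 : ℕ) * q + a ^ (4 : ℕ) * (1 - a) ^ (2 : ℕ) * b ^ (4 : ℕ) * (1 - b) ^ (2 : ℕ) * c ^ (4 : ℕ) * (1 - c) ^ (2 : ℕ) * q
          + a ^ (5 : ℕ) * (1 - a) * b ^ (2 : ℕ) * (1 - b) ^ (4 : ℕ) * c ^ (3 : ℕ) * (1 - c) ^ (3 : ℕ) * q + a ^ (5 : ℕ) * (1 - a) * b ^ (3 : ℕ) * (1 - b) ^ (3 : ℕ) * c ^ (2 : ℕ) * (1 - c) ^ (4 : ℕ) * q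
          + a ^ (5 : ℕ) * (1 - a) * b ^ (3 : ℕ) * (1 - b) ^ (3 : ℕ) * c ^ (3 : ℕ) * (1 - c) ^ (3 : ℕ) + a ^ (5 : ℕ) * (1 - a) * b ^ (3 : ℕ) * (1 - b) ^ (3 : ℕ) * c ^ (3 : ℕ) * (1 - c) ^ (3 : ℕ) * q := by
      simp only [harmCap, harmPhi, hE2, hE3, hx, hy, hz, V5.total, ThreeApex.leaf]; ring
    rw [e]; positivity
  · rename_i w
    have e : harmCap q (ThreeApex.edgeAB w) = 0 := by
      simp only [harmCap, harmPhi, hE2, hE3, hx, hy, hz, V5.total, ThreeApex.edgeAB]; ring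
    rw [e]
  · rename_i w
    have e : harmCap q (ThreeApex.edgeAC w) = 0 := by
      simp only [harmCap, harmPhi, hE2, hE3, hx, hy, hz, V5.total, ThreeApex.edgeAC]; ring
    rw [e]
  · rename_i w
    have e : harmCap q (ThreeApex.edgeBC w) = 0 := by
      simp only [harmCap, harmPhi, hE2, hE3, hx, hy, hz, V5.total, ThreeApex.edgeBC]; ring
    rw [e]

/-! ### Degenerate words: `e₂ = 0` forces `E ≤ 1` via the caps -/

/-- If two of the two-block masses vanish (`e₂ = 0`) and `Z₀ > 0`, the caps give `v̂ û² ≤ x̂ŷẑ` (`E ≤ 1`). [folklore] -/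
theorem le_W_of_hE2_zero {q : ℝ} {Z : V5} (hN : Z.Nonneg) (hA : 0 ≤ capA q Z) (hB : 0 ≤ capB q Z)
    (he : hE2 Z.zab Z.zac Z.zbc = 0) : Z.total * Z.z0 ^ 3 ≤ hx Z * hy Z * hz Z * Z.z0 := by
  rcases hE2_eq_zero hN.hab hN.hac hN.hbc he with h0 | ⟨h1, h2⟩
  · have ex : hx Z = Z.z0 := by simp only [hx, h0, add_zero]
    have : capA q Z = hx Z * hy Z * hz Z * Z.z0 - Z.total * Z.z0 ^ 3 := by simp only [capA, ex]; ring
    linarith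
  · have ey : hy Z = Z.z0 := by simp only [hy, h1, add_zero]
    have : capB q Z = hx Z * hy Z * hz Z * Z.z0 - Z.total * Z.z0 ^ 3 := by simp only [capB, ey]; ring
    linarith

/-! ### The degenerate step and the monoid -/

/-- **Degenerate step.**  If the first factor has `E ≤ 1` (`v u² ≤ W`, `u > 0`) and the second factor's functional is non-negative at
the rescaled product masses `n/u`, then the product functional is non-negative at `n`. [folklore] -/
theorem harmPhi_degenerate {W v u W₁ v₁ u₁ q n₁ n₂ n₃ : ℝ} (hv : 0 ≤ v) (hu : 0 < u) (hW₁ : 0 ≤ W₁) (hu₁ : 0 ≤ u₁)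
    (hq0 : 0 ≤ q) (hn₁ : 0 ≤ n₁) (hn₂ : 0 ≤ n₂) (hn₃ : 0 ≤ n₃) (hE : v * u ^ 2 ≤ W)
    (hΦ : 0 ≤ harmPhi W₁ v₁ u₁ q (n₁ / u) (n₂ / u) (n₃ / u)) :
    0 ≤ harmPhi (W₁ * W) (v₁ * v) (u₁ * u) q n₁ n₂ n₃ := by
  have he2 := hE2_nonneg hn₁ hn₂ hn₃
  have he3 := hE3_nonneg hn₁ hn₂ hn₃
  have hu0 : u ≠ 0 := hu.ne'
  have e3 : hE3 (n₁ / u) (n₂ / u) (n₃ / u) * u ^ 3 = hE3 n₁ n₂ n₃ := by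
    unfold hE3
    rw [div_mul_div_comm, div_mul_div_comm, show u * u * u = u ^ 3 by ring, div_mul_cancel₀ _ (pow_ne_zero 3 hu0)]
  have e2 : hE2 (n₁ / u) (n₂ / u) (n₃ / u) * u ^ 2 = hE2 n₁ n₂ n₃ := by
    unfold hE2; field_simp
  have scale : harmPhi W₁ v₁ u₁ q (n₁ / u) (n₂ / u) (n₃ / u) * u ^ 3
      = W₁ * (u₁ * u * hE2 n₁ n₂ n₃ + q * hE3 n₁ n₂ n₃) - v₁ * u₁ ^ 3 * u * hE2 n₁ n₂ n₃ := by
    rw [← e3, ← e2]; unfold harmPhi; ring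
  have hK : 0 ≤ W₁ * (u₁ * u * hE2 n₁ n₂ n₃ + q * hE3 n₁ n₂ n₃) - v₁ * u₁ ^ 3 * u * hE2 n₁ n₂ n₃ := by
    rw [← scale]; exact mul_nonneg hΦ (pow_nonneg hu.le 3)
  have hM : 0 ≤ W₁ * (u₁ * u * hE2 n₁ n₂ n₃ + q * hE3 n₁ n₂ n₃) := by positivity
  have key : harmPhi (W₁ * W) (v₁ * v) (u₁ * u) q n₁ n₂ n₃
      = W * (W₁ * (u₁ * u * hE2 n₁ n₂ n₃ + q * hE3 n₁ n₂ n₃)) - v * u ^ 2 * (v₁ * u₁ ^ 3 * u * hE2 n₁ n₂ n₃) := by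
    unfold harmPhi; ring
  rw [key]
  nlinarith [mul_le_mul_of_nonneg_right hE hM, mul_nonneg (mul_nonneg hv (pow_nonneg hu.le 2)) hK]

/-- `harmPhi` is symmetric in the two factors of a product (the parameters enter as products). [folklore] -/
theorem harmPhi_comm_factors (W v u W₁ v₁ u₁ q n₁ n₂ n₃ : ℝ) :
    harmPhi (W₁ * W) (v₁ * v) (u₁ * u) q n₁ n₂ n₃ = harmPhi (W * W₁) (v * v₁) (u * u₁) q n₁ n₂ n₃ := by
  unfold harmPhi; ring

/-- The harmonic cap of a product in terms of the factors (hat coordinates multiply; `m'_g = (u₁ + z_g)Z_g + z_g u`). [folklore] -/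
theorem harmCap_conv (q : ℝ) (z Z : V5) : harmCap q (conv z Z) =
    harmPhi ((hx z * hy z * hz z) * (hx Z * hy Z * hz Z)) (z.total * Z.total) (z.z0 * Z.z0) q
      ((z.z0 + z.zab) * Z.zab + z.zab * Z.z0) ((z.z0 + z.zac) * Z.zac + z.zac * Z.z0) ((z.z0 + z.zbc) * Z.zbc + z.zbc * Z.z0) := by
  obtain ⟨h0, hX, hY, hZ', hT⟩ := hat_conv z Z
  unfold harmCap
  rw [hX, hY, hZ', hT, h0]
  have e1 : (conv z Z).zab = (z.z0 + z.zab) * Z.zab + z.zab * Z.z0 := by simp only [conv]; ring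
  have e2 : (conv z Z).zac = (z.z0 + z.zac) * Z.zac + z.zac * Z.z0 := by simp only [conv]; ring
  have e3 : (conv z Z).zbc = (z.z0 + z.zbc) * Z.zbc + z.zbc * Z.z0 := by simp only [conv]; ring
  rw [e1, e2, e3]
  unfold harmPhi; ring

/-- **THE HARMONIC CAP.** For every `Z` in the three-apex monoid and `0 ≤ q ≤ 1`:
`x̂ŷẑ·(û·e₂ + q·e₃) ≥ v̂·û³·e₂`, i.e. `E = v̂û²/(x̂ŷẑ) ≤ 1 + q/(û/Z_ab + û/Z_ac + û/Z_bc)`. [folklore] -/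
theorem InK.harmCap_nonneg {q : ℝ} (hq0 : 0 ≤ q) (hq1 : q ≤ 1) {Z : V5} (h : InK q Z) : 0 ≤ harmCap q Z := by
  induction h with
  | base => simp [harmCap, harmPhi, hE2, hE3, hx, hy, hz, V5.total, delta0]
  | @step z Z hl hZ ih =>
    have hzK : InK q z := hl.inK_aux
    obtain ⟨g0, g1, g2, g3, g4⟩ := hl.nonneg hq0
    obtain ⟨h0, h1, h2, h3, h4⟩ := hZ.nonneg hq0
    have gt : 0 ≤ z.total := V5.Nonneg.total ⟨g0, g1, g2, g3, g4⟩
    have ht : 0 ≤ Z.total := V5.Nonneg.total ⟨h0, h1, h2, h3, h4⟩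
    have ex : 0 ≤ hx z := by simp only [hx]; positivity
    have ey : 0 ≤ hy z := by simp only [hy]; positivity
    have ez : 0 ≤ hz z := by simp only [hz]; positivity
    have eX : 0 ≤ hx Z := by simp only [hx]; positivity
    have eY : 0 ≤ hy Z := by simp only [hy]; positivity
    have eZ : 0 ≤ hz Z := by simp only [hz]; positivity
    have hletter : 0 ≤ harmCap q z := hl.harmCap_nonneg hq0
    unfold harmCap at ih hletter
    rw [harmCap_conv]
    have hm₁ : 0 ≤ (z.z0 + z.zab) * Z.zab + z.zab * Z.z0 := by positivity
    have hm₂ : 0 ≤ (z.z0 + z.zac) * Z.zac + z.zac * Z.z0 := by positivity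
    have hm₃ : 0 ≤ (z.z0 + z.zbc) * Z.zbc + z.zbc * Z.z0 := by positivity
    have he3' := hE3_nonneg hm₁ hm₂ hm₃
    have caseA : z.z0 * Z.z0 = 0 → 0 ≤ harmPhi ((hx z * hy z * hz z) * (hx Z * hy Z * hz Z)) (z.total * Z.total) (z.z0 * Z.z0) q
        ((z.z0 + z.zab) * Z.zab + z.zab * Z.z0) ((z.z0 + z.zac) * Z.zac + z.zac * Z.z0) ((z.z0 + z.zbc) * Z.zbc + z.zbc * Z.z0) := by
      intro hU
      have e : harmPhi ((hx z * hy z * hz z) * (hx Z * hy Z * hz Z)) (z.total * Z.total) (z.z0 * Z.z0) q ((z.z0 + z.zab) * Z.zab + z.zab * Z.z0) ((z.z0 + z.zac) * Z.zac + z.zac * Z.z0) ((z.z0 + z.zbc) * Z.zbc + z.zbc * Z.z0)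
          = (hx z * hy z * hz z) * (hx Z * hy Z * hz Z) * (q * hE3 ((z.z0 + z.zab) * Z.zab + z.zab * Z.z0) ((z.z0 + z.zac) * Z.zac + z.zac * Z.z0) ((z.z0 + z.zbc) * Z.zbc + z.zbc * Z.z0)) := by
        rw [hU]; unfold harmPhi; ring
      rw [e]; positivity
    rcases eq_or_lt_of_le g0 with hu₁ | hu₁
    · exact caseA (by rw [← hu₁, zero_mul])
    rcases eq_or_lt_of_le h0 with hu | hu
    · exact caseA (by rw [← hu, mul_zero])
    rcases eq_or_lt_of_le (hE2_nonneg h1 h2 h3) with heZ | heZ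
    · have hW : Z.total * Z.z0 ^ 3 ≤ hx Z * hy Z * hz Z * Z.z0 :=
        le_W_of_hE2_zero (hZ.nonneg hq0) (hZ.capA_nonneg hq0 hq1) (hZ.capB_nonneg hq0 hq1) heZ.symm
      have hW' : Z.total * Z.z0 ^ 2 ≤ hx Z * hy Z * hz Z :=
        le_of_mul_le_mul_right (by rw [show Z.total * Z.z0 ^ 2 * Z.z0 = Z.total * Z.z0 ^ 3 by ring]; exact hW) hu
      have hcase : z.total * z.z0 ^ 3 ≤ hx z * hy z * hz z * z.z0 ∨ 0 < hE2 z.zab z.zac z.zbc := by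
        rcases eq_or_lt_of_le (hE2_nonneg g1 g2 g3) with hez | hez
        · exact Or.inl (le_W_of_hE2_zero (hl.nonneg hq0) (hzK.capA_nonneg hq0 hq1) (hzK.capB_nonneg hq0 hq1) hez.symm)
        · exact Or.inr hez
      have hmono := harmPhi_mono (q := q) (n₁ := ((z.z0 + z.zab) * Z.zab + z.zab * Z.z0) / Z.z0)
        (n₂ := ((z.z0 + z.zac) * Z.zac + z.zac * Z.z0) / Z.z0) (n₃ := ((z.z0 + z.zbc) * Z.zbc + z.zbc * Z.z0) / Z.z0)
        (mul_nonneg (mul_nonneg ex ey) ez) hq0 g1 g2 g3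
        (by rw [le_div_iff₀ hu]; have := mul_nonneg (add_nonneg g0 g1) h1; linarith)
        (by rw [le_div_iff₀ hu]; have := mul_nonneg (add_nonneg g0 g2) h2; linarith)
        (by rw [le_div_iff₀ hu]; have := mul_nonneg (add_nonneg g0 g3) h3; linarith) hcase hletter
      exact harmPhi_degenerate ht hu (mul_nonneg (mul_nonneg ex ey) ez) hu₁.le hq0 hm₁ hm₂ hm₃ hW' hmono
    rcases eq_or_lt_of_le (hE2_nonneg g1 g2 g3) with hez | hez
    · have hW : z.total * z.z0 ^ 3 ≤ hx z * hy z * hz z * z.z0 :=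
        le_W_of_hE2_zero (hl.nonneg hq0) (hzK.capA_nonneg hq0 hq1) (hzK.capB_nonneg hq0 hq1) hez.symm
      have hW' : z.total * z.z0 ^ 2 ≤ hx z * hy z * hz z :=
        le_of_mul_le_mul_right (by rw [show z.total * z.z0 ^ 2 * z.z0 = z.total * z.z0 ^ 3 by ring]; exact hW) hu₁
      have hmono := harmPhi_mono (q := q) (n₁ := ((z.z0 + z.zab) * Z.zab + z.zab * Z.z0) / z.z0)
        (n₂ := ((z.z0 + z.zac) * Z.zac + z.zac * Z.z0) / z.z0) (n₃ := ((z.z0 + z.zbc) * Z.zbc + z.zbc * Z.z0) / z.z0)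
        (mul_nonneg (mul_nonneg eX eY) eZ) hq0 h1 h2 h3
        (by rw [le_div_iff₀ hu₁]; have := mul_nonneg h1 g1; have := mul_nonneg g1 h0; nlinarith [mul_nonneg g0 h1])
        (by rw [le_div_iff₀ hu₁]; have := mul_nonneg h2 g2; nlinarith [mul_nonneg g0 h2, mul_nonneg g2 h0])
        (by rw [le_div_iff₀ hu₁]; have := mul_nonneg h3 g3; nlinarith [mul_nonneg g0 h3, mul_nonneg g3 h0])
        (Or.inr heZ) ih
      rw [harmPhi_comm_factors]
      exact harmPhi_degenerate gt hu₁ (mul_nonneg (mul_nonneg eX eY) eZ) hu.le hq0 hm₁ hm₂ hm₃ hW' hmono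
    exact harmPhi_step (mul_nonneg (mul_nonneg eX eY) eZ) ht hu.le (mul_nonneg (mul_nonneg ex ey) ez) gt hu₁.le hq0 hq1
      h1 h2 h3 g1 g2 g3 ih hletter heZ hez

/-- Ratio form of the harmonic cap: `v̂ û³ e₂ ≤ x̂ŷẑ (û e₂ + q e₃)` on the monoid. [folklore] -/
theorem InK.total_harm_le {q : ℝ} (hq0 : 0 ≤ q) (hq1 : q ≤ 1) {Z : V5} (h : InK q Z) :
    Z.total * Z.z0 ^ 3 * hE2 Z.zab Z.zac Z.zbc ≤
      hx Z * hy Z * hz Z * (Z.z0 * hE2 Z.zab Z.zac Z.zbc + q * hE3 Z.zab Z.zac Z.zbc) := by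
  have := h.harmCap_nonneg hq0 hq1
  unfold harmCap harmPhi at this
  linarith

end ThreeApex

end FK

end Summit.CriticalPhenomena.PercolationContinuityZ3.Theorems
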